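import Summits.AnomalousDissipation.AnomalousDissipation.Theorems.SawtoothPulseCascadeK1LocalisedCascadeClassBlockCT

/-!
# K1loc, line `Spectral` — helper: MULTI-BLOCK CLASS STEPS, CORNER-TRACE GRADE (S-D, arbiter A24-4: p1 types the phase-3 CT
class-level sums; 1:1 port of `…ClassBlocksOsc`)

`…ClassBlocksOsc.tsum_class_{v,h}step_blocks_osc_le` with the Osc window blocks replaced by the CT blocks of `…ClassBlockCT`
(`sum_block_iterate_{v,h}step_ct_le`, all scalars discharged): blocks `[Λ_m, Λ_{m+1})` of fibres, blockwise plateaux `p_m`,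
box-trapezoid sources `|l| ≤ L_m + R_m` (plateau `L_m`), real gap bounds `D_m`, a window symmetric under the fibre reflection,
zone parameter `M` and `ε ≥ e^{−M²/2}`; the block junk amplitude is `√J_CT,m + √J_round,m` (closed forms of `…ClassBlockCT`),
the feed class and the far tail are exactly those of `…ClassBlocksOsc`.  Same geometry binders (`p, q, Λb, Mb, W, hqW, hW, hWp,
Dm, hD, Pf, hPf`) so the downstream ratio/strip sums port verbatim.
-/

-- `Summit.<Summit>.<Problem>`: single-conjunct summit, the duplicate namespace segment is deliberate.
set_option linter.dupNamespace false

noncomputable section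

namespace Summit.AnomalousDissipation.AnomalousDissipation.Theorems.SawtoothPulseCascade.K1Window

open MeasureTheory Set Filter Topology UnitAddTorus Function Complex Metric
open scoped Real ENNReal
open Literature.Analysis Literature.Analysis.FunctionSpaces Literature.Analysis.FunctionSpaces.Torus Literature.Analysis.FluidPDE
open Literature.Analysis.FluidPDE.ShearStage
open Literature.Analysis.FluidPDE.SawtoothCascade Literature.Analysis.FluidPDE.SawtoothCascade.CascadeParams
open Summit.AnomalousDissipation.AnomalousDissipation.Theorems.SawtoothPulseCascade.K1Start
open Summit.AnomalousDissipation.AnomalousDissipation.Theorems.SawtoothPulseCascade.K1Flat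
open Summit.AnomalousDissipation.AnomalousDissipation.Theorems.SawtoothPulseCascade.K1Ledger.From

section Cascade

variable (P : CascadeParams)

/-- **A V-CLASS OF `a_{j+1}` SUMMED OVER FIBRE BLOCKS, CT GRADE** (see the file header): blocks `[Λ_m, Λ_{m+1})`, `m < M_b`, of
fibres `k₁`, a finite window `W ⊇ {q} ∩ {|k₁| < Λ_{M_b}}` inside `{Λ₀ ≤ |k₁| < Λ_{M_b}}`, symmetric under `k₁ ↦ −k₁`, with
blockwise plateau `|k₀| + (L_m+R_m) ≤ p_m(k₁)` and gap `D_m ≤ |k₁|G − p_m(k₁)`; feed predicate `P` implied by `L_m < |k₀|` on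
block `m`.  `Σ'[q]‖𝓕a_{j+1}‖² ≤ (√(Σ_m (√J_CT,m + √J_round,m)²) + √(Σ'[P]‖𝓕b_j‖²))² + ((1+γ)^{2(j+1)}/Λ_{M_b})²`.
[cite: Grafakos2014, Prop. 3.1.2 (5), Prop. 3.2.7 (3)] -/
theorem tsum_class_vstep_blocks_ct_le {G : ℕ} (hγ : P.γ = G) (hδ₀ : 0 < P.δ₀) (hd : 0 < P.d) (hN₀ : 1 ≤ P.N₀)
    (hρN : 1 ≤ P.ρN) (a b : ℕ → UnitAddTorus (Fin 2) → ℝ) (has : ∀ j, IsSmooth (a j)) (h0 : a 0 = datum)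
    (hb : ∀ j, b j = a j ∘ shearMap 0 1 (amp ⟨P.U j, P.U_periodic j, P.contDiff_U (P.δ_pos hδ₀ hd j)⟩ P.γ))
    (hab : ∀ j, a (j + 1) = b j ∘ shearMap 1 0 (amp ⟨P.U j, P.U_periodic j, P.contDiff_U (P.δ_pos hδ₀ hd j)⟩ P.γ))
    (j : ℕ) (p : ℕ → ℤ → ℕ) (q : (Fin 2 → ℤ) → Prop) [DecidablePred q]
    (Λb : ℕ → ℕ) (hΛb : Monotone Λb) (hΛ0 : 1 ≤ Λb 0) (Mb : ℕ)
    (W : Finset (Fin 2 → ℤ)) (hqW : ∀ k, q k → |k 1| < (Λb Mb : ℤ) → k ∈ W)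
    (hW : ∀ k ∈ W, (Λb 0 : ℤ) ≤ |k 1| ∧ |k 1| < (Λb Mb : ℤ))
    (L R : ℕ → ℕ) (hR : ∀ m, 0 < R m)
    (hWp : ∀ m, ∀ k ∈ W, (Λb m : ℤ) ≤ |k 1| → |k 1| < (Λb (m + 1) : ℤ) →
      |k 0| + ((L m + R m : ℕ) : ℤ) ≤ (p m (k 1) : ℤ))
    (Dm : ℕ → ℝ) (hDm : ∀ m, 0 < Dm m) (hD : ∀ m, ∀ k ∈ W, (Λb m : ℤ) ≤ |k 1| → |k 1| < (Λb (m + 1) : ℤ) →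
      Dm m ≤ (((k 1).natAbs * G : ℕ) : ℝ) - p m (k 1))
    (hWsym : ∀ k ∈ W, Function.update k 1 (-k 1) ∈ W)
    {M ε : ℝ} (hM : 1 ≤ M) (hMδ : M * P.δ j < π / 2) (hε : Real.exp (-(M ^ 2 / 2)) ≤ ε)
    (Pf : (Fin 2 → ℤ) → Prop) [DecidablePred Pf]
    (hPf : ∀ m, ∀ k : Fin 2 → ℤ, (Λb m : ℤ) ≤ |k 1| → |k 1| < (Λb (m + 1) : ℤ) → (L m : ℤ) < |k 0| → Pf k) :
    ∑' k : Fin 2 → ℤ, (if q k then (1 : ℝ) else 0) * ‖mFourierCoeff (fun x => (a (j + 1) x : ℂ)) k‖ ^ 2 ≤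
      (Real.sqrt (∑ m ∈ Finset.range Mb,
          (Real.sqrt (3 * P.N j * (1 / (Dm m + ((L m + R m : ℕ) : ℝ)) ^ 2 + 1 / (P.N j * (Dm m + ((L m + R m : ℕ) : ℝ)))) /
                π ^ 2 * (2 * P.N j * ((Real.sqrt ((2 * L m + R m : ℕ) * R m) / R m * 1) ^ 2 / 2 +
                  (Real.sqrt ((2 * L m + R m : ℕ) * R m) / R m * 1) ^ 2 / 2)) +
              12 * (P.N j : ℝ) ^ 2 * ((L m + R m : ℕ) : ℝ) ^ 2 * (2 * ((L m + R m : ℕ) : ℝ) / P.N j + 1) *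
                (1 / (Dm m + ((L m + R m : ℕ) : ℝ)) ^ 2 + 1 / (P.N j * (Dm m + ((L m + R m : ℕ) : ℝ)))) /
                (π ^ 2 * Dm m ^ 2) * 1) +
            Real.sqrt ((π * ((Λb (m + 1) * G : ℕ) : ℝ) * ε / P.N j) ^ 2 * 1 +
              8 * M * P.δ j / π * ((Real.sqrt ((2 * L m + R m : ℕ) * R m) / R m * 1) ^ 2 / 2 +
                (Real.sqrt ((2 * L m + R m : ℕ) * R m) / R m * 1) ^ 2 / 2))) ^ 2) +
          Real.sqrt (∑' k : Fin 2 → ℤ, (if Pf k then (1 : ℝ) else 0) * ‖mFourierCoeff (fun x => (b j x : ℂ)) k‖ ^ 2)) ^ 2 +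
        ((1 + P.γ) ^ (2 * (j + 1)) / Λb Mb) ^ 2 := by
  classical
  have hγ0 : 0 ≤ P.γ := by rw [hγ]; exact Nat.cast_nonneg G
  have hbs : IsSmooth (b j) := isSmooth_b P hδ₀ hd a b has hb j
  have hac : Continuous fun x => (a (j + 1) x : ℂ) := by
    rw [hab j]; exact Complex.continuous_ofReal.comp (hbs.continuous.comp (continuous_shearMap 1 0 _))
  set ca : (Fin 2 → ℤ) → ℝ := fun k => ‖mFourierCoeff (fun x => (a (j + 1) x : ℂ)) k‖ ^ 2 with hca
  set cb : (Fin 2 → ℤ) → ℝ := fun k => ‖mFourierCoeff (fun x => (b j x : ℂ)) k‖ ^ 2 with hcb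
  have hcas : Summable ca := (hasSum_sq_mFourierCoeff_of_continuous hac).summable
  have hcbs : Summable cb :=
    (hasSum_sq_mFourierCoeff_of_continuous (Complex.continuous_ofReal.comp hbs.continuous)).summable
  have hca0 : ∀ k, 0 ≤ ca k := fun k => sq_nonneg _
  have hcb0 : ∀ k, 0 ≤ cb k := fun k => sq_nonneg _
  have hIb : ∀ (r : (Fin 2 → ℤ) → Prop) [DecidablePred r], Summable fun k => (if r k then (1 : ℝ) else 0) * cb k := by
    intro r _
    refine Summable.of_nonneg_of_le (fun k => mul_nonneg (by split_ifs <;> norm_num) (hcb0 k)) (fun k => ?_) hcbs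
    exact mul_le_of_le_one_left (hcb0 k) (by split_ifs <;> norm_num)
  -- Step 1: far split at `Λ_M`
  have hMb1 : 1 ≤ Λb Mb := hΛ0.trans (hΛb (Nat.zero_le Mb))
  have hMb0 : (0 : ℝ) < Λb Mb := by exact_mod_cast hMb1
  have h1 := tsum_indicator_le_sum_add_far_of_lt hcas hca0 q 1 (Λb Mb) W hqW
  have hfar := tsum_far_iterate_le P hγ0 hδ₀ hd a b has h0 hb hab (j + 1) 1 (R := (Λb Mb : ℝ)) hMb0
  -- Step 2: the window along the blocks
  have hΛz : Monotone (fun m => (Λb m : ℤ)) := fun m n h => by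
    show (Λb m : ℤ) ≤ (Λb n : ℤ)
    exact_mod_cast hΛb h
  have hWeq : W.filter (fun k => (Λb 0 : ℤ) ≤ |k 1| ∧ |k 1| < (Λb Mb : ℤ)) = W :=
    Finset.filter_true_of_mem fun k hk => hW k hk
  have h2 : ∑ k ∈ W, ca k =
      ∑ m ∈ Finset.range Mb, ∑ k ∈ W.filter (fun k => (Λb m : ℤ) ≤ |k 1| ∧ |k 1| < (Λb (m + 1) : ℤ)), ca k := by
    conv_lhs => rw [← hWeq]
    exact sum_filter_blocks_eq W ca (fun k : Fin 2 → ℤ => |k 1|) hΛz Mb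
  -- Step 3: each block
  set u : ℕ → ℝ := fun m =>
    Real.sqrt (3 * P.N j * (1 / (Dm m + ((L m + R m : ℕ) : ℝ)) ^ 2 + 1 / (P.N j * (Dm m + ((L m + R m : ℕ) : ℝ)))) /
          π ^ 2 * (2 * P.N j * ((Real.sqrt ((2 * L m + R m : ℕ) * R m) / R m * 1) ^ 2 / 2 +
            (Real.sqrt ((2 * L m + R m : ℕ) * R m) / R m * 1) ^ 2 / 2)) +
        12 * (P.N j : ℝ) ^ 2 * ((L m + R m : ℕ) : ℝ) ^ 2 * (2 * ((L m + R m : ℕ) : ℝ) / P.N j + 1) *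
          (1 / (Dm m + ((L m + R m : ℕ) : ℝ)) ^ 2 + 1 / (P.N j * (Dm m + ((L m + R m : ℕ) : ℝ)))) /
          (π ^ 2 * Dm m ^ 2) * 1) +
      Real.sqrt ((π * ((Λb (m + 1) * G : ℕ) : ℝ) * ε / P.N j) ^ 2 * 1 +
        8 * M * P.δ j / π * ((Real.sqrt ((2 * L m + R m : ℕ) * R m) / R m * 1) ^ 2 / 2 +
          (Real.sqrt ((2 * L m + R m : ℕ) * R m) / R m * 1) ^ 2 / 2)) with hu
  set y : ℕ → ℝ := fun m => ∑' k : Fin 2 → ℤ,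
    (if (Λb m : ℤ) ≤ |k 1| ∧ |k 1| < (Λb (m + 1) : ℤ) ∧ (L m : ℤ) < |k 0| then (1 : ℝ) else 0) * cb k with hy
  have hu0 : ∀ m, 0 ≤ u m := fun m => add_nonneg (Real.sqrt_nonneg _) (Real.sqrt_nonneg _)
  have hy0 : ∀ m, 0 ≤ y m := fun m => tsum_nonneg fun k => mul_nonneg (by split_ifs <;> norm_num) (hcb0 k)
  have hblock : ∀ m, ∑ k ∈ W.filter (fun k => (Λb m : ℤ) ≤ |k 1| ∧ |k 1| < (Λb (m + 1) : ℤ)), ca k ≤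
      (u m + Real.sqrt (y m)) ^ 2 := fun m =>
    sum_block_iterate_vstep_ct_le P hγ hδ₀ hd hN₀ hρN a b has h0 hb hab j (p m) W (hΛ0.trans (hΛb (Nat.zero_le _))) (hR m)
      (hWp m) (hDm m) (hD m) hWsym hM hMδ hε
  -- Step 4: ℓ²-Minkowski over the blocks
  have h4 : ∑ m ∈ Finset.range Mb, ∑ k ∈ W.filter (fun k => (Λb m : ℤ) ≤ |k 1| ∧ |k 1| < (Λb (m + 1) : ℤ)), ca k ≤
      (Real.sqrt (∑ m ∈ Finset.range Mb, u m ^ 2) + Real.sqrt (∑ m ∈ Finset.range Mb, y m)) ^ 2 :=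
    sum_le_sq_sqrt_add_sqrt (Finset.range Mb) (fun m _ => hu0 m) (fun m _ => hy0 m) (fun m _ => hblock m)
  -- Step 5: the pass-through energies of the blocks add up to at most the feed class
  have h5 : ∑ m ∈ Finset.range Mb, y m ≤ ∑' k : Fin 2 → ℤ, (if Pf k then (1 : ℝ) else 0) * cb k := by
    have hle : ∀ m, y m ≤ ∑' k : Fin 2 → ℤ, (if (Λb m : ℤ) ≤ |k 1| ∧ |k 1| < (Λb (m + 1) : ℤ) ∧
        ((Λb m : ℤ) ≤ |k 1| ∧ |k 1| < (Λb (m + 1) : ℤ) ∧ (L m : ℤ) < |k 0|) then (1 : ℝ) else 0) * cb k := fun m =>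
      (hIb _).tsum_le_tsum (fun k => indicator_mul_le_of_imp (fun h => ⟨h.1, h.2.1, h⟩) (hcb0 k)) (hIb _)
    have hsum := sum_tsum_blocks_le hcbs hcb0 (fun k : Fin 2 → ℤ => |k 1|) hΛz Pf
      (fun m k => (Λb m : ℤ) ≤ |k 1| ∧ |k 1| < (Λb (m + 1) : ℤ) ∧ (L m : ℤ) < |k 0|)
      (fun m k h => hPf m k h.1 h.2.1 h.2.2) Mb
    refine ((Finset.sum_le_sum fun m _ => hle m).trans hsum).trans ?_
    exact (hIb _).tsum_le_tsum (fun k => indicator_mul_le_of_imp (fun h => h.2) (hcb0 k)) (hIb _)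
  -- Step 6: assemble
  have h6 : ∑ k ∈ W, ca k ≤ (Real.sqrt (∑ m ∈ Finset.range Mb, u m ^ 2) +
      Real.sqrt (∑' k : Fin 2 → ℤ, (if Pf k then (1 : ℝ) else 0) * cb k)) ^ 2 := by
    rw [h2]
    exact le_add_sq_mono h4 (Real.sqrt_nonneg _) (Real.sqrt_nonneg _) le_rfl (Real.sqrt_le_sqrt h5)
  exact h1.trans (add_le_add h6 hfar)


/-- **AN H-CLASS OF `b_j` SUMMED OVER FIBRE BLOCKS, CT GRADE**: the same with fibres `k₀`, sources in `k₁`, feed from `a_j`,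
far tail `((1+γ)^{2j}/Λ_{M_b})²`. [cite: Grafakos2014, Prop. 3.1.2 (5), Prop. 3.2.7 (3)] -/
theorem tsum_class_hstep_blocks_ct_le {G : ℕ} (hγ : P.γ = G) (hδ₀ : 0 < P.δ₀) (hd : 0 < P.d) (hN₀ : 1 ≤ P.N₀)
    (hρN : 1 ≤ P.ρN) (a b : ℕ → UnitAddTorus (Fin 2) → ℝ) (has : ∀ j, IsSmooth (a j)) (h0 : a 0 = datum)
    (hb : ∀ j, b j = a j ∘ shearMap 0 1 (amp ⟨P.U j, P.U_periodic j, P.contDiff_U (P.δ_pos hδ₀ hd j)⟩ P.γ))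
    (hab : ∀ j, a (j + 1) = b j ∘ shearMap 1 0 (amp ⟨P.U j, P.U_periodic j, P.contDiff_U (P.δ_pos hδ₀ hd j)⟩ P.γ))
    (j : ℕ) (p : ℕ → ℤ → ℕ) (q : (Fin 2 → ℤ) → Prop) [DecidablePred q]
    (Λb : ℕ → ℕ) (hΛb : Monotone Λb) (hΛ0 : 1 ≤ Λb 0) (Mb : ℕ)
    (W : Finset (Fin 2 → ℤ)) (hqW : ∀ k, q k → |k 0| < (Λb Mb : ℤ) → k ∈ W)
    (hW : ∀ k ∈ W, (Λb 0 : ℤ) ≤ |k 0| ∧ |k 0| < (Λb Mb : ℤ))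
    (L R : ℕ → ℕ) (hR : ∀ m, 0 < R m)
    (hWp : ∀ m, ∀ k ∈ W, (Λb m : ℤ) ≤ |k 0| → |k 0| < (Λb (m + 1) : ℤ) →
      |k 1| + ((L m + R m : ℕ) : ℤ) ≤ (p m (k 0) : ℤ))
    (Dm : ℕ → ℝ) (hDm : ∀ m, 0 < Dm m) (hD : ∀ m, ∀ k ∈ W, (Λb m : ℤ) ≤ |k 0| → |k 0| < (Λb (m + 1) : ℤ) →
      Dm m ≤ (((k 0).natAbs * G : ℕ) : ℝ) - p m (k 0))
    (hWsym : ∀ k ∈ W, Function.update k 0 (-k 0) ∈ W)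
    {M ε : ℝ} (hM : 1 ≤ M) (hMδ : M * P.δ j < π / 2) (hε : Real.exp (-(M ^ 2 / 2)) ≤ ε)
    (Pf : (Fin 2 → ℤ) → Prop) [DecidablePred Pf]
    (hPf : ∀ m, ∀ k : Fin 2 → ℤ, (Λb m : ℤ) ≤ |k 0| → |k 0| < (Λb (m + 1) : ℤ) → (L m : ℤ) < |k 1| → Pf k) :
    ∑' k : Fin 2 → ℤ, (if q k then (1 : ℝ) else 0) * ‖mFourierCoeff (fun x => (b j x : ℂ)) k‖ ^ 2 ≤
      (Real.sqrt (∑ m ∈ Finset.range Mb,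
          (Real.sqrt (3 * P.N j * (1 / (Dm m + ((L m + R m : ℕ) : ℝ)) ^ 2 + 1 / (P.N j * (Dm m + ((L m + R m : ℕ) : ℝ)))) /
                π ^ 2 * (2 * P.N j * ((Real.sqrt ((2 * L m + R m : ℕ) * R m) / R m * 1) ^ 2 / 2 +
                  (Real.sqrt ((2 * L m + R m : ℕ) * R m) / R m * 1) ^ 2 / 2)) +
              12 * (P.N j : ℝ) ^ 2 * ((L m + R m : ℕ) : ℝ) ^ 2 * (2 * ((L m + R m : ℕ) : ℝ) / P.N j + 1) *
                (1 / (Dm m + ((L m + R m : ℕ) : ℝ)) ^ 2 + 1 / (P.N j * (Dm m + ((L m + R m : ℕ) : ℝ)))) /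
                (π ^ 2 * Dm m ^ 2) * 1) +
            Real.sqrt ((π * ((Λb (m + 1) * G : ℕ) : ℝ) * ε / P.N j) ^ 2 * 1 +
              8 * M * P.δ j / π * ((Real.sqrt ((2 * L m + R m : ℕ) * R m) / R m * 1) ^ 2 / 2 +
                (Real.sqrt ((2 * L m + R m : ℕ) * R m) / R m * 1) ^ 2 / 2))) ^ 2) +
          Real.sqrt (∑' k : Fin 2 → ℤ, (if Pf k then (1 : ℝ) else 0) * ‖mFourierCoeff (fun x => (a j x : ℂ)) k‖ ^ 2)) ^ 2 +
        ((1 + P.γ) ^ (2 * j) / Λb Mb) ^ 2 := by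
  classical
  have hγ0 : 0 ≤ P.γ := by rw [hγ]; exact Nat.cast_nonneg G
  have hbs : IsSmooth (b j) := isSmooth_b P hδ₀ hd a b has hb j
  have hbc : Continuous fun x => (b j x : ℂ) := Complex.continuous_ofReal.comp hbs.continuous
  set ca : (Fin 2 → ℤ) → ℝ := fun k => ‖mFourierCoeff (fun x => (b j x : ℂ)) k‖ ^ 2 with hca
  set cb : (Fin 2 → ℤ) → ℝ := fun k => ‖mFourierCoeff (fun x => (a j x : ℂ)) k‖ ^ 2 with hcb
  have hcas : Summable ca := (hasSum_sq_mFourierCoeff_of_continuous hbc).summable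
  have hcbs : Summable cb :=
    (hasSum_sq_mFourierCoeff_of_continuous (Complex.continuous_ofReal.comp (has j).continuous)).summable
  have hca0 : ∀ k, 0 ≤ ca k := fun k => sq_nonneg _
  have hcb0 : ∀ k, 0 ≤ cb k := fun k => sq_nonneg _
  have hIb : ∀ (r : (Fin 2 → ℤ) → Prop) [DecidablePred r], Summable fun k => (if r k then (1 : ℝ) else 0) * cb k := by
    intro r _
    refine Summable.of_nonneg_of_le (fun k => mul_nonneg (by split_ifs <;> norm_num) (hcb0 k)) (fun k => ?_) hcbs
    exact mul_le_of_le_one_left (hcb0 k) (by split_ifs <;> norm_num)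
  -- Step 1: far split at `Λ_M`
  have hMb1 : 1 ≤ Λb Mb := hΛ0.trans (hΛb (Nat.zero_le Mb))
  have hMb0 : (0 : ℝ) < Λb Mb := by exact_mod_cast hMb1
  have h1 := tsum_indicator_le_sum_add_far_of_lt hcas hca0 q 0 (Λb Mb) W hqW
  have hfar := tsum_far_halfIterate_fst_le P hγ0 hδ₀ hd a b has h0 hb hab j (R := (Λb Mb : ℝ)) hMb0
  -- Step 2: the window along the blocks
  have hΛz : Monotone (fun m => (Λb m : ℤ)) := fun m n h => by
    show (Λb m : ℤ) ≤ (Λb n : ℤ)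
    exact_mod_cast hΛb h
  have hWeq : W.filter (fun k => (Λb 0 : ℤ) ≤ |k 0| ∧ |k 0| < (Λb Mb : ℤ)) = W :=
    Finset.filter_true_of_mem fun k hk => hW k hk
  have h2 : ∑ k ∈ W, ca k =
      ∑ m ∈ Finset.range Mb, ∑ k ∈ W.filter (fun k => (Λb m : ℤ) ≤ |k 0| ∧ |k 0| < (Λb (m + 1) : ℤ)), ca k := by
    conv_lhs => rw [← hWeq]
    exact sum_filter_blocks_eq W ca (fun k : Fin 2 → ℤ => |k 0|) hΛz Mb
  -- Step 3: each block
  set u : ℕ → ℝ := fun m =>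
    Real.sqrt (3 * P.N j * (1 / (Dm m + ((L m + R m : ℕ) : ℝ)) ^ 2 + 1 / (P.N j * (Dm m + ((L m + R m : ℕ) : ℝ)))) /
          π ^ 2 * (2 * P.N j * ((Real.sqrt ((2 * L m + R m : ℕ) * R m) / R m * 1) ^ 2 / 2 +
            (Real.sqrt ((2 * L m + R m : ℕ) * R m) / R m * 1) ^ 2 / 2)) +
        12 * (P.N j : ℝ) ^ 2 * ((L m + R m : ℕ) : ℝ) ^ 2 * (2 * ((L m + R m : ℕ) : ℝ) / P.N j + 1) *
          (1 / (Dm m + ((L m + R m : ℕ) : ℝ)) ^ 2 + 1 / (P.N j * (Dm m + ((L m + R m : ℕ) : ℝ)))) /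
          (π ^ 2 * Dm m ^ 2) * 1) +
      Real.sqrt ((π * ((Λb (m + 1) * G : ℕ) : ℝ) * ε / P.N j) ^ 2 * 1 +
        8 * M * P.δ j / π * ((Real.sqrt ((2 * L m + R m : ℕ) * R m) / R m * 1) ^ 2 / 2 +
          (Real.sqrt ((2 * L m + R m : ℕ) * R m) / R m * 1) ^ 2 / 2)) with hu
  set y : ℕ → ℝ := fun m => ∑' k : Fin 2 → ℤ,
    (if (Λb m : ℤ) ≤ |k 0| ∧ |k 0| < (Λb (m + 1) : ℤ) ∧ (L m : ℤ) < |k 1| then (1 : ℝ) else 0) * cb k with hy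
  have hu0 : ∀ m, 0 ≤ u m := fun m => add_nonneg (Real.sqrt_nonneg _) (Real.sqrt_nonneg _)
  have hy0 : ∀ m, 0 ≤ y m := fun m => tsum_nonneg fun k => mul_nonneg (by split_ifs <;> norm_num) (hcb0 k)
  have hblock : ∀ m, ∑ k ∈ W.filter (fun k => (Λb m : ℤ) ≤ |k 0| ∧ |k 0| < (Λb (m + 1) : ℤ)), ca k ≤
      (u m + Real.sqrt (y m)) ^ 2 := fun m =>
    sum_block_iterate_hstep_ct_le P hγ hδ₀ hd hN₀ hρN a b has h0 hb hab j (p m) W (hΛ0.trans (hΛb (Nat.zero_le _))) (hR m)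
      (hWp m) (hDm m) (hD m) hWsym hM hMδ hε
  -- Step 4: ℓ²-Minkowski over the blocks
  have h4 : ∑ m ∈ Finset.range Mb, ∑ k ∈ W.filter (fun k => (Λb m : ℤ) ≤ |k 0| ∧ |k 0| < (Λb (m + 1) : ℤ)), ca k ≤
      (Real.sqrt (∑ m ∈ Finset.range Mb, u m ^ 2) + Real.sqrt (∑ m ∈ Finset.range Mb, y m)) ^ 2 :=
    sum_le_sq_sqrt_add_sqrt (Finset.range Mb) (fun m _ => hu0 m) (fun m _ => hy0 m) (fun m _ => hblock m)
  -- Step 5: the pass-through energies of the blocks add up to at most the feed class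
  have h5 : ∑ m ∈ Finset.range Mb, y m ≤ ∑' k : Fin 2 → ℤ, (if Pf k then (1 : ℝ) else 0) * cb k := by
    have hle : ∀ m, y m ≤ ∑' k : Fin 2 → ℤ, (if (Λb m : ℤ) ≤ |k 0| ∧ |k 0| < (Λb (m + 1) : ℤ) ∧
        ((Λb m : ℤ) ≤ |k 0| ∧ |k 0| < (Λb (m + 1) : ℤ) ∧ (L m : ℤ) < |k 1|) then (1 : ℝ) else 0) * cb k := fun m =>
      (hIb _).tsum_le_tsum (fun k => indicator_mul_le_of_imp (fun h => ⟨h.1, h.2.1, h⟩) (hcb0 k)) (hIb _)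
    have hsum := sum_tsum_blocks_le hcbs hcb0 (fun k : Fin 2 → ℤ => |k 0|) hΛz Pf
      (fun m k => (Λb m : ℤ) ≤ |k 0| ∧ |k 0| < (Λb (m + 1) : ℤ) ∧ (L m : ℤ) < |k 1|)
      (fun m k h => hPf m k h.1 h.2.1 h.2.2) Mb
    refine ((Finset.sum_le_sum fun m _ => hle m).trans hsum).trans ?_
    exact (hIb _).tsum_le_tsum (fun k => indicator_mul_le_of_imp (fun h => h.2) (hcb0 k)) (hIb _)
  -- Step 6: assemble
  have h6 : ∑ k ∈ W, ca k ≤ (Real.sqrt (∑ m ∈ Finset.range Mb, u m ^ 2) +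
      Real.sqrt (∑' k : Fin 2 → ℤ, (if Pf k then (1 : ℝ) else 0) * cb k)) ^ 2 := by
    rw [h2]
    exact le_add_sq_mono h4 (Real.sqrt_nonneg _) (Real.sqrt_nonneg _) le_rfl (Real.sqrt_le_sqrt h5)
  exact h1.trans (add_le_add h6 hfar)

end Cascade

end Summit.AnomalousDissipation.AnomalousDissipation.Theorems.SawtoothPulseCascade.K1Window
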